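import Summits.BirchSwinnertonDyer.BirchSwinnertonDyer.Theorems.ManinLocalTwoThreeVeluThreeDiscriminant
import Literature.NumberTheory.EllipticCurves.LatticeIndexTwoHalfPeriodProofs
import HarnessLib

/-!
# The Vélu `2`-quotient by a rational `2`-torsion point: `Δ(W/T)·B³ = Δ(W)²` (exact, modulo the `2`-division relation), the
# Néron-scaling dichotomy `u ∣ 2`, and the minimal discriminant of `W/T` at EVERY prime (MEMO-an §67: S-an-45, S-an-39, E-an-119 (a))

Summit `BirchSwinnertonDyer`, route `ManinLocalTwoThree` (cell bsd-f2-manin), deciding crux C2 `ManinOddAtFour`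
(stmt-BirchSwinnertonDyer-22967) and C3 (stmt-…-22968); the `p = 2` twin of `…VeluThreeDiscriminant` / `…TameThreeNeronScalarExists`.
With `q` the short-model abscissa of a rational `2`-torsion point (`Ψ₂²_W(q − b₂/12) = 0`, i.e. `4q³ − c₄q/12 − c₆/216 = 0`),
`B = 3q² − c₄/48` (the tree's Vélu `B`, `velu_B_identity`) and the `u = 1` Vélu `2`-pair `(720q² − 4c₄, 19008q³ − 144c₄q)`
(`c₄, c₆` of Vélu's curve `[0, −6q, 0, 9q² − 4B, 0]`, Silverman *AEC* III.4.5):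

* `velu_two_Δ_mul_pow_three_eq` — **S-an-45 exactly**: `Δ^{Vélu}·B³ = Δ²` modulo the `2`-division relation (12-term certificate);
* `velu_two_Δ_mul_B_pow_three` (curve form), `velu_two_B_ne_zero`, `velu_two_Δ_ne_zero`, `padicValRat_velu_two_Δ`
  (`ord_p Δ(T) + 3·ord_p B = 2·ord_p Δ(W)` for every carrier `T` of the pair, every prime `p`);
* `exists_half_period_of_Ψ₂Sq_root` — a rational `2`-torsion abscissa is `℘(z₀)` for a half-period `z₀`;
* `exists_isGloballyMinimal_dvd_two_velu_two` — **the dichotomy at `2` (S-an-39) with bookkeeping (E-an-119 (a))**: for ANY globally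
  minimal `W/ℚ` there are a globally minimal `W'` and `k ∣ 2` with `k⁴c₄(W')`, `k⁶c₆(W')` = the Vélu `2`-pair and, at every prime,
  `ord_p Δ_min(W') + 3·ord_p B + 12·ord_p k = 2·ord_p Δ_min(W)` (`Λ_{W'} = u(Λ_W + ℤz₀)`, `u ∈ ℤ`, `u ∣ 2` by
  `exists_int_eq_and_dvd_of_neronScaling`; Vélu's lattice `lattice_eq_of_velu_invariants`).

HONEST FRAMING: algebra and lattice bookkeeping; C2, C3, Manin's conjecture and BSD are not proved.  No definitions, no named facts,
no sorry.  References: [SilvermanAEC2009] III.4.5, VI.3.6, VIII.8; [DokchitserDokchitser2015LocalInvariants] §4 Lemma 10–11, Table 1;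
J. Vélu, C. R. Acad. Sci. Paris 273 (1971); HOME/MEMO-an.md §67 (S-an-45 census 712 502 / 0).
-/

set_option linter.dupNamespace false
set_option autoImplicit false

noncomputable section

open scoped Classical

open WeierstrassCurve IsDedekindDomain NumberField Rat.HeightOneSpectrum Polynomial
  Literature.NumberTheory.DiophantineGeometry Literature.NumberTheory.EllipticCurves
  Literature.NumberTheory.EllipticCurves.ModularForms
  Summit.BirchSwinnertonDyer.Rank1Residual.Additive

namespace Summit.BirchSwinnertonDyer.BirchSwinnertonDyer.Theorems.ManinLocalTwoThree

/-! ### §1 The identity -/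

/-- **S-an-45, exact form: `Δ^{Vélu}·B³ = Δ²` modulo the `2`-division relation** (`B = 3q² − c₄/48`; 12-term multiplier of
`Ψ₂² = 4q³ − c₄q/12 − c₆/216`). [cite: SilvermanAEC2009, III.4 Example 4.5] -/
theorem velu_two_Δ_mul_pow_three_eq {K : Type*} [Field K] [CharZero K] (c4 c6 q : K)
    (hΨ : 4 * q ^ 3 - c4 / 12 * q - c6 / 216 = 0) :
    ((720 * q ^ 2 - 4 * c4) ^ 3 - (19008 * q ^ 3 - 144 * c4 * q) ^ 2) / 1728 * (3 * q ^ 2 - c4 / 48) ^ 3 =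
      ((c4 ^ 3 - c6 ^ 2) / 1728) ^ 2 := by
  linear_combination ((1 / 384 : ℚ) * c4 ^ 4 * q + (-1 / 6912 : ℚ) * c4 ^ 3 * c6 + (-35 / 64 : ℚ) * c4 ^ 3 * q ^ 3 + (3 / 128 : ℚ) * c4 ^ 2 * c6 * q ^ 2 + (243 / 4 : ℚ) * c4 ^ 2 * q ^ 5 + (-1 / 768 : ℚ) * c4 * c6 ^ 2 * q + (-9 / 4 : ℚ) * c4 * c6 * q ^ 4 + (-2916 : ℚ) * c4 * q ^ 7 + (1 / 13824 : ℚ) * c6 ^ 3 + (1 / 16 : ℚ) * c6 ^ 2 * q ^ 3 + (54 : ℚ) * c6 * q ^ 6 + (46656 : ℚ) * q ^ 9) * hΨ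

/-! ### §2 Curve form and valuations -/

/-- **`Δ(T) · B³ = Δ(W)²` for every carrier `T` of the `u = 1` Vélu `2`-pair of a rational `2`-torsion abscissa.**
[cite: SilvermanAEC2009, III.4 Example 4.5] -/
theorem velu_two_Δ_mul_B_pow_three (W : WeierstrassCurve ℚ) (q : ℚ) (hq : W.Ψ₂Sq.eval (q - W.b₂ / 12) = 0)
    (T : WeierstrassCurve ℚ) (h4 : T.c₄ = 720 * q ^ 2 - 4 * W.c₄) (h6 : T.c₆ = 19008 * q ^ 3 - 144 * W.c₄ * q) :
    T.Δ * (3 * q ^ 2 - W.c₄ / 48) ^ 3 = W.Δ ^ 2 := by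
  rw [Ψ₂Sq_eval_sub_b₂_div_twelve_explicit] at hq
  have hid := velu_two_Δ_mul_pow_three_eq W.c₄ W.c₆ q hq
  have hT : T.Δ = ((720 * q ^ 2 - 4 * W.c₄) ^ 3 - (19008 * q ^ 3 - 144 * W.c₄ * q) ^ 2) / 1728 := by
    have h := T.c_relation; rw [h4, h6] at h; linear_combination h / 1728
  have hW : W.Δ = (W.c₄ ^ 3 - W.c₆ ^ 2) / 1728 := by linear_combination W.c_relation / 1728
  rw [hT, hW]
  exact hid

/-- `B = 3q² − c₄/48 ≠ 0` at a rational `2`-torsion abscissa of an elliptic `W`. [folklore] -/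
theorem velu_two_B_ne_zero (W : WeierstrassCurve ℚ) [W.IsElliptic] (q : ℚ) (hq : W.Ψ₂Sq.eval (q - W.b₂ / 12) = 0) :
    3 * q ^ 2 - W.c₄ / 48 ≠ 0 := by
  intro h0
  set T : WeierstrassCurve ℚ := ⟨0, 0, 0, -(720 * q ^ 2 - 4 * W.c₄) / 48, -(19008 * q ^ 3 - 144 * W.c₄ * q) / 864⟩ with hT
  have h4 : T.c₄ = 720 * q ^ 2 - 4 * W.c₄ := by
    simp only [hT, WeierstrassCurve.c₄, WeierstrassCurve.b₂, WeierstrassCurve.b₄]; ring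
  have h6 : T.c₆ = 19008 * q ^ 3 - 144 * W.c₄ * q := by
    simp only [hT, WeierstrassCurve.c₆, WeierstrassCurve.b₂, WeierstrassCurve.b₄, WeierstrassCurve.b₆]; ring
  have h := velu_two_Δ_mul_B_pow_three W q hq T h4 h6
  rw [h0] at h
  have hΔ : W.Δ ≠ 0 := by rw [← WeierstrassCurve.coe_Δ']; exact W.Δ'.ne_zero
  exact pow_ne_zero 2 hΔ (by simpa using h.symm)

/-- **The Vélu `2`-pair of a rational `2`-torsion point is nonsingular**: every carrier has `Δ ≠ 0`. [folklore] -/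
theorem velu_two_Δ_ne_zero (W : WeierstrassCurve ℚ) [W.IsElliptic] (q : ℚ) (hq : W.Ψ₂Sq.eval (q - W.b₂ / 12) = 0)
    (T : WeierstrassCurve ℚ) (h4 : T.c₄ = 720 * q ^ 2 - 4 * W.c₄) (h6 : T.c₆ = 19008 * q ^ 3 - 144 * W.c₄ * q) :
    T.Δ ≠ 0 := by
  intro h0
  have h := velu_two_Δ_mul_B_pow_three W q hq T h4 h6
  rw [h0, zero_mul] at h
  have hΔ : W.Δ ≠ 0 := by rw [← WeierstrassCurve.coe_Δ']; exact W.Δ'.ne_zero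
  exact pow_ne_zero 2 hΔ h.symm

/-- **`ord_p Δ(T) + 3·ord_p B = 2·ord_p Δ(W)` at every prime** (S-an-45, valuation form).
[cite: DokchitserDokchitser2015LocalInvariants, Table 1] -/
theorem padicValRat_velu_two_Δ (p : ℕ) [Fact p.Prime] (W : WeierstrassCurve ℚ) [W.IsElliptic] (q : ℚ)
    (hq : W.Ψ₂Sq.eval (q - W.b₂ / 12) = 0) (T : WeierstrassCurve ℚ) (h4 : T.c₄ = 720 * q ^ 2 - 4 * W.c₄)
    (h6 : T.c₆ = 19008 * q ^ 3 - 144 * W.c₄ * q) :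
    padicValRat p T.Δ + 3 * padicValRat p (3 * q ^ 2 - W.c₄ / 48) = 2 * padicValRat p W.Δ := by
  have h := congrArg (padicValRat p) (velu_two_Δ_mul_B_pow_three W q hq T h4 h6)
  rw [padicValRat.mul (velu_two_Δ_ne_zero W q hq T h4 h6) (pow_ne_zero _ (velu_two_B_ne_zero W q hq)),
    padicValRat.pow (3 * q ^ 2 - W.c₄ / 48), padicValRat.pow W.Δ] at h
  push_cast at h
  linarith

/-! ### §3 Half-periods and the dichotomy at `2` -/

/-- **A rational `2`-torsion abscissa is `℘` of a half-period**: if `Ψ₂²_W(q − b₂/12) = 0` and `L` is a Néron-type period pair of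
`W/ℂ`, there is `z₀ ∉ Λ` with `℘_Λ(z₀) = q` and `2z₀ ∈ Λ`. [cite: SilvermanAEC2009, Prop. VI.3.6(b) and Exercise 3.7(f)] -/
theorem exists_half_period_of_Ψ₂Sq_root (W : WeierstrassCurve ℚ) [W.IsElliptic] {L : PeriodPair}
    (hL : IsNeronLatticeOf (W.baseChange ℂ) L) (q : ℚ) (hq : W.Ψ₂Sq.eval (q - W.b₂ / 12) = 0) :
    ∃ z₀ : ℂ, z₀ ∉ L.lattice ∧ L.weierstrassP z₀ = (q : ℂ) ∧ 2 * z₀ ∈ L.lattice := by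
  obtain ⟨z₀, hz₀, hx₀⟩ := L.exists_weierstrassP_eq (q : ℂ)
  refine ⟨z₀, hz₀, hx₀, ?_⟩
  have hc₄ : (W.baseChange ℂ).c₄ = (W.c₄ : ℂ) := by simp [WeierstrassCurve.baseChange, WeierstrassCurve.map_c₄]
  have hc₆ : (W.baseChange ℂ).c₆ = (W.c₆ : ℂ) := by simp [WeierstrassCurve.baseChange, WeierstrassCurve.map_c₆]
  have hg₂ : L.g₂ = (W.c₄ : ℂ) / 12 := by rw [hL.1, hc₄]
  have hg₃ : L.g₃ = (W.c₆ : ℂ) / 216 := by rw [hL.2, hc₆]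
  rw [Ψ₂Sq_eval_sub_b₂_div_twelve_explicit] at hq
  have hqC : ((4 * q ^ 3 - W.c₄ / 12 * q - W.c₆ / 216 : ℚ) : ℂ) = 0 := by rw [hq]; simp
  push_cast at hqC
  have hΨ : (L.curve.ΨSq 2).eval (L.weierstrassP z₀) = 0 := by
    rw [WeierstrassCurve.ΨSq_two]
    simp only [WeierstrassCurve.Ψ₂Sq, WeierstrassCurve.b₂, WeierstrassCurve.b₄, WeierstrassCurve.b₆, PeriodPair.curve_a₁,
      PeriodPair.curve_a₂, PeriodPair.curve_a₃, PeriodPair.curve_a₄, PeriodPair.curve_a₆, eval_add, eval_mul, eval_pow, eval_C,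
      eval_X, hx₀, hg₂, hg₃]
    linear_combination hqC
  exact_mod_cast (L.eval_ΨSq_weierstrassP_eq_zero_iff hz₀ 2).mp hΨ

/-- The divisors of `2` in `ℤ`. -/
private theorem int_dvd_two {k : ℤ} (hk : k ∣ 2) : k = 1 ∨ k = -1 ∨ k = 2 ∨ k = -2 := by
  have h1 : k.natAbs ∣ 2 := by exact_mod_cast Int.natAbs_dvd_natAbs.mpr hk
  have h2 : k.natAbs = 1 ∨ k.natAbs = 2 := (Nat.dvd_prime Nat.prime_two).mp h1
  omega

/-- **The Néron-scaling dichotomy of the Vélu `2`-quotient, with its discriminant bookkeeping at every prime (S-an-39 + E-an-119 (a)).**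
`W/ℚ` globally minimal (any reduction), `q` the short-model abscissa of a rational `2`-torsion point: there are a globally minimal
`W'` and `k ∣ 2` with `k⁴c₄(W') = 720q² − 4c₄`, `k⁶c₆(W') = 19008q³ − 144c₄q`, and at every prime `p`
`ord_p Δ_min(W') + 3·ord_p(3q² − c₄/48) + 12·ord_p k = 2·ord_p Δ_min(W)`.
[cite: DokchitserDokchitser2015LocalInvariants, §4 Lemma 10 (1) and proof of Lemma 11] [cite: SilvermanAEC2009, III.4.5 and VIII.8.3] -/
theorem exists_isGloballyMinimal_dvd_two_velu_two (W : WeierstrassCurve ℚ) [W.IsElliptic] [W.IsGloballyMinimal]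
    (q : ℚ) (hq : W.Ψ₂Sq.eval (q - W.b₂ / 12) = 0) :
    ∃ (W' : WeierstrassCurve ℚ) (k : ℤ) (_ : W'.IsElliptic) (_ : W'.IsGloballyMinimal), k ∣ 2 ∧ k ≠ 0 ∧
      (k : ℚ) ^ 4 * W'.c₄ = 720 * q ^ 2 - 4 * W.c₄ ∧ (k : ℚ) ^ 6 * W'.c₆ = 19008 * q ^ 3 - 144 * W.c₄ * q ∧
      ∀ (p : ℕ) [Fact p.Prime], (padicValInt p W'.minimalDiscriminantInt : ℤ) +
        3 * padicValRat p (3 * q ^ 2 - W.c₄ / 48) + 12 * (padicValInt p k : ℤ) = 2 * padicValInt p W.minimalDiscriminantInt := by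
  set A : ℚ := 720 * q ^ 2 - 4 * W.c₄ with hA
  set Bv : ℚ := 19008 * q ^ 3 - 144 * W.c₄ * q with hBv
  set Bq : ℚ := 3 * q ^ 2 - W.c₄ / 48 with hBq
  -- Vélu's curve (short carrier) and its global minimal model
  set V : WeierstrassCurve ℚ := ⟨0, 0, 0, -A / 48, -Bv / 864⟩ with hV
  have hV4 : V.c₄ = A := by simp only [hV, WeierstrassCurve.c₄, WeierstrassCurve.b₂, WeierstrassCurve.b₄]; ring
  have hV6 : V.c₆ = Bv := by
    simp only [hV, WeierstrassCurve.c₆, WeierstrassCurve.b₂, WeierstrassCurve.b₄, WeierstrassCurve.b₆]; ring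
  haveI hVell : V.IsElliptic := ⟨isUnit_iff_ne_zero.mpr (velu_two_Δ_ne_zero W q hq V hV4 hV6)⟩
  obtain ⟨C, hC⟩ := WeierstrassCurve.hasGlobalMinimalModel_rat_holds V
  haveI := hC
  set u : ℚ := (C.u : ℚ) with hu
  have hu0 : u ≠ 0 := C.u.ne_zero
  have hW'4 : (C • V).c₄ = (u ^ 4)⁻¹ * A := by rw [variableChange_c₄, hV4, Units.val_inv_eq_inv_val, inv_pow]
  have hW'6 : (C • V).c₆ = (u ^ 6)⁻¹ * Bv := by rw [variableChange_c₆, hV6, Units.val_inv_eq_inv_val, inv_pow]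
  -- lattices
  haveI : (V.baseChange ℂ).IsElliptic := by rw [WeierstrassCurve.baseChange]; infer_instance
  haveI : (W.baseChange ℂ).IsElliptic := by rw [WeierstrassCurve.baseChange]; infer_instance
  haveI : ((C • V).baseChange ℂ).IsElliptic := by rw [WeierstrassCurve.baseChange]; infer_instance
  obtain ⟨L₀, hL₀⟩ := exists_isNeronLatticeOf_holds (W.baseChange ℂ)
  obtain ⟨LV, hLV⟩ := exists_isNeronLatticeOf_holds (V.baseChange ℂ)
  obtain ⟨L', hL'⟩ := exists_isNeronLatticeOf_holds ((C • V).baseChange ℂ)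
  have hΛ' : L'.lattice = (LV.mulLeft ((C.u : ℚ) : ℂ) (by exact_mod_cast C.u.ne_zero)).lattice :=
    IsNeronLatticeOf.lattice_eq_mulLeft_of_smul C hLV hL'
  obtain ⟨z₀, hz₀, hx₀, h2⟩ := exists_half_period_of_Ψ₂Sq_root W hL₀ q hq
  have hc₄W : (W.baseChange ℂ).c₄ = (W.c₄ : ℂ) := by simp [WeierstrassCurve.baseChange, WeierstrassCurve.map_c₄]
  have hc₄V : (V.baseChange ℂ).c₄ = (V.c₄ : ℂ) := by simp [WeierstrassCurve.baseChange, WeierstrassCurve.map_c₄]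
  have hc₆V : (V.baseChange ℂ).c₆ = (V.c₆ : ℂ) := by simp [WeierstrassCurve.baseChange, WeierstrassCurve.map_c₆]
  have hB : ((Bq : ℚ) : ℂ) = 3 * L₀.weierstrassP z₀ ^ 2 - L₀.g₂ / 4 := by
    rw [hx₀, hL₀.1, hc₄W, hBq]; push_cast; ring
  have hB0 : ((Bq : ℚ) : ℂ) ≠ 0 := by exact_mod_cast velu_two_B_ne_zero W q hq
  have h₂ : LV.g₂ = 12 * L₀.weierstrassP z₀ ^ 2 + 16 * ((Bq : ℚ) : ℂ) := by
    rw [hLV.1, hc₄V, hV4, hx₀, hA, hBq]; push_cast; ring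
  have h₃ : LV.g₃ = -8 * L₀.weierstrassP z₀ ^ 3 + 32 * ((Bq : ℚ) : ℂ) * L₀.weierstrassP z₀ := by
    rw [hLV.2, hc₆V, hV6, hx₀, hBv, hBq]; push_cast; ring
  obtain ⟨hle, -, hidx⟩ := L₀.lattice_eq_of_velu_invariants hz₀ h2 hB hB0 LV h₂ h₃
  -- the Néron scaling divides 2
  have hu0' : (u : ℂ) ≠ 0 := by exact_mod_cast hu0
  have h2mul : ∀ w : ℂ, w ∈ L₀.lattice → 2 * w ∈ L₀.lattice := fun w hw ↦ by
    have e : (2 : ℂ) * w = w + w := by ring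
    rw [e]; exact add_mem hw hw
  have h2v : ∀ v : ℂ, v ∈ LV.lattice → 2 * v ∈ L₀.lattice := fun v hv ↦ by
    rcases hidx v hv with h | h
    · exact h2mul v h
    · have e : (2 : ℂ) * v = 2 * (v - z₀) + 2 * z₀ := by ring
      rw [e]; exact add_mem (h2mul _ h) h2
  have hμ : ∀ y ∈ L₀.lattice, ((u : ℚ) : ℂ) * y ∈ L'.lattice := fun y hy ↦ by
    rw [hΛ']; exact PeriodPair.mul_mem_mulLeft_lattice.mpr (hle hy)
  have hnμ : ∀ z ∈ L'.lattice, ∃ y ∈ L₀.lattice, ((2 : ℤ) : ℂ) * z = ((u : ℚ) : ℂ) * y := fun z hz ↦ by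
    rw [hΛ', PeriodPair.mem_mulLeft_lattice] at hz
    refine ⟨2 * (((u : ℚ) : ℂ)⁻¹ * z), h2v _ hz, ?_⟩
    field_simp
    push_cast; ring
  obtain ⟨k, hk, hk2⟩ :=
    exists_int_eq_and_dvd_of_neronScaling W (C • V) L₀ L' hL₀ hL' u (n := 2) two_ne_zero hμ hnμ
  have hk0 : k ≠ 0 := by rintro rfl; norm_num at hk2
  refine ⟨C • V, k, inferInstance, hC, hk2, hk0, ?_, ?_, fun p _ ↦ ?_⟩
  · rw [hW'4, hk]; field_simp
  · rw [hW'6, hk]; field_simp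
  -- bookkeeping: the rescaled model (k⁻¹; 0,0,0) • (C • V) carries the pair
  have hkQ : (k : ℚ) ≠ 0 := by exact_mod_cast hk0
  set C' : VariableChange ℚ := ⟨Units.mk0 ((k : ℚ)⁻¹) (inv_ne_zero hkQ), 0, 0, 0⟩ with hC'
  have hu' : ((C'.u⁻¹ : ℚˣ) : ℚ) = k := by rw [Units.val_inv_eq_inv_val, hC', Units.val_mk0, inv_inv]
  have h4' : (k : ℚ) ^ 4 * (C • V).c₄ = A := by rw [hW'4, hk]; field_simp
  have h6' : (k : ℚ) ^ 6 * (C • V).c₆ = Bv := by rw [hW'6, hk]; field_simp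
  have hS4 : (C' • (C • V)).c₄ = 720 * q ^ 2 - 4 * W.c₄ := by rw [variableChange_c₄, hu', h4']
  have hS6 : (C' • (C • V)).c₆ = 19008 * q ^ 3 - 144 * W.c₄ * q := by rw [variableChange_c₆, hu', h6']
  have hSΔ : (C' • (C • V)).Δ = (k : ℚ) ^ 12 * ((C • V).minimalDiscriminantInt : ℚ) := by
    rw [variableChange_Δ, hu', cast_minimalDiscriminantInt]
  have hv := padicValRat_velu_two_Δ p W q hq (C' • (C • V)) hS4 hS6
  have hm0 : ((C • V).minimalDiscriminantInt : ℚ) ≠ 0 := by exact_mod_cast minimalDiscriminantInt_ne_zero (C • V)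
  rw [hSΔ, padicValRat.mul (pow_ne_zero _ hkQ) hm0, padicValRat.pow (k : ℚ), ← cast_minimalDiscriminantInt W] at hv
  simp only [padicValRat.of_int] at hv
  push_cast at hv
  linarith

end Summit.BirchSwinnertonDyer.BirchSwinnertonDyer.Theorems.ManinLocalTwoThree

end
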